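import Summits.QuantumFields.YangMills.Theorems.VirialFluxGapAssemblyPackages
import Summits.QuantumFields.YangMills.Theorems.VirialFluxGapAssemblyScale
import Summits.QuantumFields.YangMills.Theorems.VirialFluxGapFieldPatching
import Summits.QuantumFields.YangMills.Theorems.VirialFluxGapPeriodicSoftnessOfSmoothFrameField
import HarnessLib

/-!
# Route `VirialFluxGap` (YangMills): `PeriodicSoftness` FROM A CENTRAL FIELD PACKAGE — ASSEMBLY OF THE PATCHED EULER FIELD ON `X_fix`, PART IV
# (generic resolvent field + cut-offs + det-localiser + signed patching + parameter choice, all discharged; the central chart is the input)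

Toward the deciding crux `VirialFluxGap.PeriodicSoftness` (item stmt-QuantumFields-24141).  THE ASSEMBLY THEOREM
★★★ `periodicSoftness_of_centralField`: the crux holds BY NAME (via w2's ✓`FixField.periodicSoftness_of_smoothFrameField_cutoff`) as soon as a
«CENTRAL FIELD PACKAGE» is supplied — constants `K_C ≥ 1`, `q_C`, `L₀` and for every `L ≥ L₀`: a radius `ρ ∈ [(K_C L^{q_C})⁻¹, 1/2]`, a window
`t_C ≥ (K_C L^{q_C})⁻¹`, a rate `0 ≤ N ≤ K_C L^{q_C}`, `ε_C ≥ 0` with `ε_C·L⁴ ≤ 1/400`, and SMOOTH coefficient functions `C_va` of the coordinates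
(`va : FixVar L × Fin 3`, frame ✓`fixFrameStd`) such that at every point `x` of `X_fix` in the CLOSED `ρ`-CENTRAL WINDOW (all four regularity
masses `≤ ρ²`, `F_fix x ≤ t_C`): (P2) drive `2(1 − ε_C)·F_fix x ≤ Σ_va C_va·g_va`, (P3) divergence `Σ_va ∂_va C_va ≤ 18L⁴ − 1/2`, (P4) mass
monotonicity `−N·√(F_fix x) ≤ Σ_va C_va·∂_va m` for the four masses `m` (w2's ✓`linkMass k`, ✓`seamMass`) — "the central field does not shrink
the regularity masses by more than `N√F`".

Everything else is discharged from the tree: the field is `c_va = ψ(F/t₀)·(χ_reg·c¹_va + (1 − χ_reg)·C_va)` with `ψ = `✓`deficitStep`,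
`χ_reg = `✓`regCutoff ρ`, `c¹ = θ·(H + λ⋆1)⁻¹g` the det-localised resolvent field (✓`generic_point_package`, `δ′ = δ₀/2` from ✓`exists_detSq_floor`),
`λ⋆ = ερ′²/(3·1032960L⁸)`, `ρ′ = ρ/√2`, `ε = (400L⁴)⁻¹`, `t₀ = s²⁰`, `s = (A·L^a)⁻¹` with `A, a` explicit in `K_C, q_C` and the three absolute
constants (✓`exists_bound_frameD3_ringPoly`, ✓`exists_frameD_sq_le_L4_ringDeficit`, ✓`exists_bound_deriv_deficitStep`); (pos)/(drive) by
✓`pos_budget` ∕ ✓`drive_budget`; (div) `≤ 18L⁴ − 7/16` by ✓`div_budget` from `div c¹ ≤ 18L⁴ − 3/4`, (P3), the signed cut-off terms and the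
SIGNED CROSS TERM ✓`regCutoff_cross_le` (smallness of `c¹` along the masses + (P4), ✓`cross_rate_le`); `c₁ = 7/32`, `K = 2A²⁰`, `q = 20a`.

* §1 ★★ `assembly_at_L` — for ONE `L`: the field and its seven clauses in the shape of ✓`periodicSoftness_of_smoothFrameField_cutoff`
  (✓`scale_package`, ✓`exists_detSq_floor`, ✓`generic_collar_package`, ✓`central_window_package`, w2's ✓`sum_patch_mul` ∕ ✓`sum_frameD_patch`,
  the budgets, the signed cross term ✓`regCutoff_cross_le`);
* Part V (`…PeriodicSoftnessOfCentralField`) then fixes the three absolute constants and `A, a` and concludes ★★★ `periodicSoftness_of_centralField`.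

HONEST LABEL: a CONDITIONAL assembly — the central package (P2)–(P4) is a HYPOTHESIS (to be supplied by the w3 lineage: explicit field
`X_z + U` of memo `w3-g59-EXPLICIT-CENTRAL-FIELD-24141.md`); no stub ∕ crux ∕ rung ∕ summit is closed by this file; ⟨24141⟩, ⟨22884⟩ remain OPEN;
the Yang–Mills mass gap is NOT proved; no summit is proved by a line.  THEOREMS ONLY (0 `def`, 0 `sorry`), standard axioms.  Explicit-unit seat
`ym-line-fcl-p3` g41 (cell ym-idea-1, free hands; default assembler per LEAD ruling 2026-08-30T23:18Z), `--supports stmt-QuantumFields-24141`.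
References: [cite: Griffiths1964]; [cite: Luscher1983, §2]; [folklore].
-/


set_option autoImplicit false

noncomputable section

open scoped Matrix BigOperators ContDiff Topology Quaternion
open MeasureTheory Set Matrix
open Literature.MathematicalPhysics.QuantumFieldTheory hiding SU2
open Literature.MathematicalPhysics.QuantumLattice
open Literature.MathematicalPhysics.QuantumFieldTheory.SUNBakryEmery (expSU coe_expSU matTop)

namespace Summit.QuantumFields.YangMills.Theorems.VirialFluxGap.FrameHessian

open Summit.QuantumFields.YangMills.Theorems.FemtoTransferGap
open Summit.QuantumFields.YangMills.Theorems.FemtoTransferGap.TT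
open Summit.QuantumFields.YangMills.Theorems.FemtoTransferGap.TwoLattice
open Summit.QuantumFields.YangMills.Theorems.FemtoTransferGap.TwoLattice.Flat
open Summit.QuantumFields.YangMills.Theorems.VirialFluxGap.RingDeficit
open Summit.QuantumFields.YangMills.Theorems.VirialFluxGap.FrameDerivative
open Summit.QuantumFields.YangMills.Theorems.VirialFluxGap.ResolventField
open Summit.QuantumFields.YangMills.Theorems.VirialFluxGap.RegularValley
open Summit.QuantumFields.YangMills.Theorems.VirialFluxGap.FixFrame
open Summit.QuantumFields.YangMills.Theorems.VirialFluxGap.RegCutoff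
open Summit.QuantumFields.YangMills.Theorems.VirialFluxGap.FieldPatching
open Summit.QuantumFields.YangMills.Theorems.VirialFluxGap.FixField
open Summit.QuantumFields.YangMills.Theorems.VirialFluxGap.PatchingBudget

variable {L : ℕ} [NeZero L]

open scoped Matrix.Norms.Frobenius

/-! ## §1 The assembly at one `L` -/

set_option maxHeartbeats 400000 in
/-- ★★ **THE ASSEMBLY AT ONE `L`.**  Absolute constants `C₃` (trilinear third-derivative bound), `C₂` (gradient–energy), `Dψ` (`|ψ′| ≤ Dψ`); a
scale `A, a` dominating the atomic constants; the central package at this `L`.  Conclusion: smooth coefficients `c` and `ε = (400L⁴)⁻¹` with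
the seven clauses of ✓`periodicSoftness_of_smoothFrameField_cutoff` for `c₁ = 7/32`, `K = 2A²⁰`, `q = 20a`. [cite: Luscher1983, §2] -/
theorem assembly_at_L [DecidableEq (FixVar L × Fin 3)]
    {C₃ : ℝ} (hC₃0 : 0 ≤ C₃)
    (hC₃ : ∀ (Q : ((Fin (2 * L - 1 + 1) → GaugeConfig 3 L SU2) × (Site 3 L → SU2)))
      (Y₁ Y₂ Y₃ : ((Fin (2 * L - 1 + 1) × Edge 3 L) ⊕ Site 3 L) → Matrix (Fin 2) (Fin 2) ℂ) (b₁ b₂ b₃ : ℝ), 0 ≤ b₁ → 0 ≤ b₂ → 0 ≤ b₃ →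
      (∀ w, ‖Y₁ w‖ ≤ b₁) → (∀ w, ‖Y₂ w‖ ≤ b₂) → (∀ w, ‖Y₃ w‖ ≤ b₃) →
      |frameD Y₁ (frameD Y₂ (frameD Y₃ (ringPoly L))) (ringCoord L Q)| ≤ C₃ * (L : ℝ) ^ 4 * b₁ * b₂ * b₃)
    {C₂ : ℝ} (hC₂0 : 0 ≤ C₂)
    (hC₂ : ∀ (Q : ((Fin (2 * L - 1 + 1) → GaugeConfig 3 L SU2) × (Site 3 L → SU2)))
      (Y : ((Fin (2 * L - 1 + 1) × Edge 3 L) ⊕ Site 3 L) → Matrix (Fin 2) (Fin 2) ℂ), (∀ w, (Y w)ᴴ = -Y w) → (∀ w, (Y w).trace = 0) →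
      ∀ b : ℝ, 0 ≤ b → (∀ w, ‖Y w‖ ≤ b) →
      (frameD Y (ringPoly L) (ringCoord L Q)) ^ 2 ≤ 2 * (C₂ * (L : ℝ) ^ 4 * b ^ 2) * ringDeficit L (fun _ => false) Q)
    {Dψ : ℝ} (hDψ0 : 0 ≤ Dψ) (hDψ : ∀ r, |deriv deficitStep r| ≤ Dψ)
    {K_C : ℝ} (hK_C : 1 ≤ K_C) {q_C : ℕ} {A : ℝ} {a : ℕ}
    (hA1 : 2 * K_C ^ 2 ≤ A) (hA2 : 400 ≤ A) (hA3 : 1032960 * 10000 ≤ A) (hA4 : (C₃ + 1) ^ 2 ≤ A) (hA5 : (21 : ℝ) ^ 5 ≤ A)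
    (hA7 : Dψ + 1 ≤ A) (hA8 : 2 * C₂ + 2 ≤ A) (ha1 : 2 * q_C ≤ a) (ha2 : 20 ≤ a)
    {ρ t_C N ε_C : ℝ}
    {C : FixVar L × Fin 3 → ((Fin (2 * L - 1 + 1) → Edge 3 L → Matrix (Fin 2) (Fin 2) ℂ) × (Site 3 L → Matrix (Fin 2) (Fin 2) ℂ)) → ℝ}
    (hρlo : (K_C * (L : ℝ) ^ q_C)⁻¹ ≤ ρ) (hρhi : ρ ≤ 1 / 2) (htC : (K_C * (L : ℝ) ^ q_C)⁻¹ ≤ t_C) (hN0 : 0 ≤ N) (hN : N ≤ K_C * (L : ℝ) ^ q_C)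
    (hεC : ε_C * (L : ℝ) ^ 4 ≤ 1 / 400) (hCs : ∀ va, ContDiff ℝ ∞ (C va))
    (hP : ∀ x : (OffIdx L → SU2) × ((Fin (2 * L - 1) → GaugeConfig 3 L SU2) × (Site 3 L → SU2)),
      (∀ k : Fin 3, 1 - (su2Quat (wrapReps ((Fin.cons (glue x.1) x.2.1 : Fin (2 * L - 1 + 1) → GaugeConfig 3 L SU2) 0) k)).re ^ 2 ≤ ρ ^ 2) →
      1 - (su2Quat (x.2.2 0)).re ^ 2 ≤ ρ ^ 2 →
      ringDeficit L (fun _ => false) ((Fin.cons (glue x.1) x.2.1 : Fin (2 * L - 1 + 1) → GaugeConfig 3 L SU2), x.2.2) ≤ t_C →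
      2 * (1 - ε_C) * ringDeficit L (fun _ => false) ((Fin.cons (glue x.1) x.2.1 : Fin (2 * L - 1 + 1) → GaugeConfig 3 L SU2), x.2.2) ≤
          ∑ va, C va (ringCoord L ((Fin.cons (glue x.1) x.2.1 : Fin (2 * L - 1 + 1) → GaugeConfig 3 L SU2), x.2.2)) *
            frameGrad (L := L) fixFrameStd (ringCoord L ((Fin.cons (glue x.1) x.2.1 : Fin (2 * L - 1 + 1) → GaugeConfig 3 L SU2), x.2.2)) va ∧
        ∑ va, frameD (fixFrameStd va) (C va) (ringCoord L ((Fin.cons (glue x.1) x.2.1 : Fin (2 * L - 1 + 1) → GaugeConfig 3 L SU2), x.2.2)) ≤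
          18 * (L : ℝ) ^ 4 - 1 / 2 ∧
        (∀ k : Fin 3, -(N * Real.sqrt (ringDeficit L (fun _ => false) ((Fin.cons (glue x.1) x.2.1 : Fin (2 * L - 1 + 1) → GaugeConfig 3 L SU2), x.2.2))) ≤
          ∑ va, C va (ringCoord L ((Fin.cons (glue x.1) x.2.1 : Fin (2 * L - 1 + 1) → GaugeConfig 3 L SU2), x.2.2)) *
            frameD (fixFrameStd va) (linkMass k) (ringCoord L ((Fin.cons (glue x.1) x.2.1 : Fin (2 * L - 1 + 1) → GaugeConfig 3 L SU2), x.2.2))) ∧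
        -(N * Real.sqrt (ringDeficit L (fun _ => false) ((Fin.cons (glue x.1) x.2.1 : Fin (2 * L - 1 + 1) → GaugeConfig 3 L SU2), x.2.2))) ≤
          ∑ va, C va (ringCoord L ((Fin.cons (glue x.1) x.2.1 : Fin (2 * L - 1 + 1) → GaugeConfig 3 L SU2), x.2.2)) *
            frameD (fixFrameStd va) seamMass (ringCoord L ((Fin.cons (glue x.1) x.2.1 : Fin (2 * L - 1 + 1) → GaugeConfig 3 L SU2), x.2.2))) :
    ∃ (c : FixVar L × Fin 3 → ((Fin (2 * L - 1 + 1) → Edge 3 L → Matrix (Fin 2) (Fin 2) ℂ) × (Site 3 L → Matrix (Fin 2) (Fin 2) ℂ)) → ℝ) (ε : ℝ),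
      (∀ va, ContDiff ℝ ∞ (c va)) ∧ 0 ≤ ε ∧ ε ≤ 1 / 4 ∧ ε * (L : ℝ) ^ 4 ≤ (7 / 32) / 72 ∧
      (∀ x : (OffIdx L → SU2) × ((Fin (2 * L - 1) → GaugeConfig 3 L SU2) × (Site 3 L → SU2)), 0 ≤ ∑ va, c va (ringCoord L ((Fin.cons (glue x.1) x.2.1 : Fin (2 * L - 1 + 1) → GaugeConfig 3 L SU2), x.2.2)) * frameGrad (L := L) fixFrameStd (ringCoord L ((Fin.cons (glue x.1) x.2.1 : Fin (2 * L - 1 + 1) → GaugeConfig 3 L SU2), x.2.2)) va) ∧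
      (∀ x : (OffIdx L → SU2) × ((Fin (2 * L - 1) → GaugeConfig 3 L SU2) × (Site 3 L → SU2)), ringDeficit L (fun _ => false) ((Fin.cons (glue x.1) x.2.1 : Fin (2 * L - 1 + 1) → GaugeConfig 3 L SU2), x.2.2) < (2 * A ^ 20 * (L : ℝ) ^ (((20 * a : ℕ) : ℝ)))⁻¹ →
        2 * (1 - ε) * ringDeficit L (fun _ => false) ((Fin.cons (glue x.1) x.2.1 : Fin (2 * L - 1 + 1) → GaugeConfig 3 L SU2), x.2.2) ≤
          ∑ va, c va (ringCoord L ((Fin.cons (glue x.1) x.2.1 : Fin (2 * L - 1 + 1) → GaugeConfig 3 L SU2), x.2.2)) * frameGrad (L := L) fixFrameStd (ringCoord L ((Fin.cons (glue x.1) x.2.1 : Fin (2 * L - 1 + 1) → GaugeConfig 3 L SU2), x.2.2)) va) ∧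
      (∀ x : (OffIdx L → SU2) × ((Fin (2 * L - 1) → GaugeConfig 3 L SU2) × (Site 3 L → SU2)), ∑ va, frameD (fixFrameStd va) (c va) (ringCoord L ((Fin.cons (glue x.1) x.2.1 : Fin (2 * L - 1 + 1) → GaugeConfig 3 L SU2), x.2.2)) ≤ 18 * (L : ℝ) ^ 4 - 2 * (7 / 32)) := by
  classical
  /- ### scale -/
  have hL1 : (1 : ℝ) ≤ L := by exact_mod_cast NeZero.one_le
  have hL0 : (0 : ℝ) < L := by positivity
  have hL4 : (1 : ℝ) ≤ (L : ℝ) ^ 4 := one_le_pow₀ hL1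
  have hKC0 : 0 < K_C := by linarith
  have hρ0 : 0 < ρ := lt_of_lt_of_le (by positivity) hρlo
  have hρ1 : ρ ≤ 1 := by linarith
  have hcard : (Fintype.card (FixVar L × Fin 3) : ℝ) = 18 * (L : ℝ) ^ 4 + 3 := card_fixVar_mul_three_real
  obtain ⟨ht₀0, ht₀C, ht₀G, hcross, hwin⟩ :=
    scale_package (L := L) hK_C hC₃0 hC₂0 hDψ0 hA1 hA2 hA3 hA4 hA5 hA7 hA8 ha1 ha2 hρlo hρhi htC hN0 hN
  set t₀ : ℝ := ((A * (L : ℝ) ^ a)⁻¹) ^ 20 with ht₀def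
  set ε : ℝ := (400 * (L : ℝ) ^ 4)⁻¹ with hεdef
  have hε0 : 0 < ε := by rw [hεdef]; positivity
  have hε1 : ε ≤ 1 := by
    rw [hεdef, inv_le_comm₀ (by positivity) one_pos, inv_one]; linarith only [hL4]
  have hε4 : ε ≤ 1 / 4 := by
    rw [hεdef, one_div, inv_le_inv₀ (by positivity) (by norm_num)]; linarith only [hL4]
  have hεL : ε * (L : ℝ) ^ 4 ≤ (7 / 32) / 72 := by
    rw [hεdef]; field_simp; norm_num
  have hεCε : ε_C ≤ ε := by
    rw [hεdef, ← one_div, le_div_iff₀ (by positivity)]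
    have e : ε_C * (400 * (L : ℝ) ^ 4) = 400 * (ε_C * (L : ℝ) ^ 4) := by ring
    rw [e]; linarith only [hεC]
  have hρ'0 : 0 < ρ / Real.sqrt 2 := by positivity
  have hρ'1 : ρ / Real.sqrt 2 ≤ 1 := by
    have h2 : (1 : ℝ) ≤ Real.sqrt 2 := by
      rw [show (1 : ℝ) = Real.sqrt 1 from Real.sqrt_one.symm]; exact Real.sqrt_le_sqrt (by norm_num)
    rw [div_le_one (by positivity)]; linarith only [hρ1, h2]
  have hAG0 : 0 ≤ Real.sqrt ((Fintype.card (FixVar L × Fin 3) : ℝ) * (2 * (C₂ * (L : ℝ) ^ 4)) /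
          ((ε * ((ρ / Real.sqrt 2) ^ 2 / (1032960 * (L : ℝ) ^ 8)) / 3) / 2) ^ 2) * Real.sqrt (4 * (Fintype.card (FixVar L × Fin 3) : ℝ)) := by
    positivity
  -- `K₃ = C₃·L⁴`
  have hK₃0 : 0 ≤ C₃ * (L : ℝ) ^ 4 := by positivity
  have hK3 : ∀ (Y₁ Y₂ Y₃ : ((Fin (2 * L - 1 + 1) × Edge 3 L) ⊕ Site 3 L) → Matrix (Fin 2) (Fin 2) ℂ) (b₁ b₂ b₃ : ℝ), 0 ≤ b₁ → 0 ≤ b₂ → 0 ≤ b₃ →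
      (∀ w, ‖Y₁ w‖ ≤ b₁) → (∀ w, ‖Y₂ w‖ ≤ b₂) → (∀ w, ‖Y₃ w‖ ≤ b₃) → ∀ Q : ((Fin (2 * L - 1 + 1) → GaugeConfig 3 L SU2) × (Site 3 L → SU2)),
      |frameD Y₁ (frameD Y₂ (frameD Y₃ (ringPoly L))) (ringCoord L Q)| ≤ C₃ * (L : ℝ) ^ 4 * b₁ * b₂ * b₃ :=
    fun Y₁ Y₂ Y₃ b₁ b₂ b₃ h1 h2 h3 hY1 hY2 hY3 Q => hC₃ Q Y₁ Y₂ Y₃ b₁ b₂ b₃ h1 h2 h3 hY1 hY2 hY3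
  /- ### the floor constant and the field -/
  obtain ⟨δ₀, hδ₀, hδ₀S⟩ := exists_detSq_floor (L := L) hρ'0 hρ'1 hK₃0 hε0 hε1 hK3
  set δ' : ℝ := δ₀ / 2 with hδ'def
  have hδ' : 0 < δ' := by rw [hδ'def]; positivity
  have hδ : ∀ x : (OffIdx L → SU2) × ((Fin (2 * L - 1) → GaugeConfig 3 L SU2) × (Site 3 L → SU2)),
      ((∃ k : Fin 3, (ρ / Real.sqrt 2) ^ 2 ≤ 1 - (su2Quat (wrapReps ((Fin.cons (glue x.1) x.2.1 : Fin (2 * L - 1 + 1) → GaugeConfig 3 L SU2) 0) k)).re ^ 2) ∨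
          (ρ / Real.sqrt 2) ^ 2 ≤ 1 - (su2Quat (x.2.2 0)).re ^ 2) →
      ringDeficit L (fun _ => false) ((Fin.cons (glue x.1) x.2.1 : Fin (2 * L - 1 + 1) → GaugeConfig 3 L SU2), x.2.2) ≤
        (ρ / Real.sqrt 2) ^ 2 * ε ^ 3 * ((ρ / Real.sqrt 2) ^ 2 / (1032960 * (L : ℝ) ^ 8)) ^ 2 /
          (1032960 * 10000 * (L : ℝ) ^ 8 * (C₃ * (L : ℝ) ^ 4 + 1) ^ 2 * (Fintype.card (FixVar L × Fin 3) : ℝ) ^ 5) →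
      2 * δ' ≤ ((frameHess (L := L) fixFrameStd (ringCoord L ((Fin.cons (glue x.1) x.2.1 : Fin (2 * L - 1 + 1) → GaugeConfig 3 L SU2), x.2.2)) +
        (ε * ((ρ / Real.sqrt 2) ^ 2 / (1032960 * (L : ℝ) ^ 8)) / 3) • (1 : Matrix (FixVar L × Fin 3) (FixVar L × Fin 3) ℝ)).det) ^ 2 := by
    intro x hreg hF
    have h := hδ₀S x hreg hF
    rw [hδ'def]; linarith only [h]
  set θf : ((Fin (2 * L - 1 + 1) → Edge 3 L → Matrix (Fin 2) (Fin 2) ℂ) × (Site 3 L → Matrix (Fin 2) (Fin 2) ℂ)) → ℝ := fun M =>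
    1 - deficitStep (((frameHess (L := L) fixFrameStd M +
      (ε * ((ρ / Real.sqrt 2) ^ 2 / (1032960 * (L : ℝ) ^ 8)) / 3) • (1 : Matrix (FixVar L × Fin 3) (FixVar L × Fin 3) ℝ)).det) ^ 2 / δ') with hθfdef
  have hθs : ContDiff ℝ ∞ θf := contDiff_detLocaliser fixFrameStd _ δ'
  have hθsupp := tsupport_detLocaliser_subset (L := L) fixFrameStd ((ε * ((ρ / Real.sqrt 2) ^ 2 / (1032960 * (L : ℝ) ^ 8)) / 3)) hδ'
  set c1 : FixVar L × Fin 3 → ((Fin (2 * L - 1 + 1) → Edge 3 L → Matrix (Fin 2) (Fin 2) ℂ) × (Site 3 L → Matrix (Fin 2) (Fin 2) ℂ)) → ℝ :=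
    fun va M => 2 * resolventCoeff (L := L) fixFrameStd ((ε * ((ρ / Real.sqrt 2) ^ 2 / (1032960 * (L : ℝ) ^ 8)) / 3)) θf va M with hc1def
  have hc1s : ∀ va, ContDiff ℝ ∞ (c1 va) := fun va =>
    contDiff_const.mul (contDiff_resolventCoeff fixFrameStd _ hθs hθsupp va)
  set cf : FixVar L × Fin 3 → ((Fin (2 * L - 1 + 1) → Edge 3 L → Matrix (Fin 2) (Fin 2) ℂ) × (Site 3 L → Matrix (Fin 2) (Fin 2) ℂ)) → ℝ :=
    fun va M => deficitStep (ringPoly L M / t₀) * (regCutoff ρ M * c1 va M + (1 - regCutoff ρ M) * C va M) with hcfdef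
  have hcfs : ∀ va, ContDiff ℝ ∞ (cf va) := fun va => contDiff_patchCoeff (contDiff_regCutoff ρ) hc1s hCs t₀ va
  /- ### the two point packages -/
  have hG : ∀ x : (OffIdx L → SU2) × ((Fin (2 * L - 1) → GaugeConfig 3 L SU2) × (Site 3 L → SU2)),
      ((∃ k : Fin 3, ρ ^ 2 / 2 ≤ linkMass k (ringCoord L ((Fin.cons (glue x.1) x.2.1 : Fin (2 * L - 1 + 1) → GaugeConfig 3 L SU2), x.2.2))) ∨
        ρ ^ 2 / 2 ≤ seamMass (ringCoord L ((Fin.cons (glue x.1) x.2.1 : Fin (2 * L - 1 + 1) → GaugeConfig 3 L SU2), x.2.2))) →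
      ringDeficit L (fun _ => false) ((Fin.cons (glue x.1) x.2.1 : Fin (2 * L - 1 + 1) → GaugeConfig 3 L SU2), x.2.2) ≤ t₀ →
      θf (ringCoord L ((Fin.cons (glue x.1) x.2.1 : Fin (2 * L - 1 + 1) → GaugeConfig 3 L SU2), x.2.2)) = 1 ∧
      0 ≤ frameGrad (L := L) fixFrameStd (ringCoord L ((Fin.cons (glue x.1) x.2.1 : Fin (2 * L - 1 + 1) → GaugeConfig 3 L SU2), x.2.2)) ⬝ᵥ
        ((frameHess (L := L) fixFrameStd (ringCoord L ((Fin.cons (glue x.1) x.2.1 : Fin (2 * L - 1 + 1) → GaugeConfig 3 L SU2), x.2.2)) +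
          (ε * ((ρ / Real.sqrt 2) ^ 2 / (1032960 * (L : ℝ) ^ 8)) / 3) • (1 : Matrix (FixVar L × Fin 3) (FixVar L × Fin 3) ℝ))⁻¹ *ᵥ
          frameGrad (L := L) fixFrameStd (ringCoord L ((Fin.cons (glue x.1) x.2.1 : Fin (2 * L - 1 + 1) → GaugeConfig 3 L SU2), x.2.2))) ∧
      (1 - ε) * ringDeficit L (fun _ => false) ((Fin.cons (glue x.1) x.2.1 : Fin (2 * L - 1 + 1) → GaugeConfig 3 L SU2), x.2.2) ≤
        (1 / 2) * (frameGrad (L := L) fixFrameStd (ringCoord L ((Fin.cons (glue x.1) x.2.1 : Fin (2 * L - 1 + 1) → GaugeConfig 3 L SU2), x.2.2)) ⬝ᵥ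
        ((frameHess (L := L) fixFrameStd (ringCoord L ((Fin.cons (glue x.1) x.2.1 : Fin (2 * L - 1 + 1) → GaugeConfig 3 L SU2), x.2.2)) +
          (ε * ((ρ / Real.sqrt 2) ^ 2 / (1032960 * (L : ℝ) ^ 8)) / 3) • (1 : Matrix (FixVar L × Fin 3) (FixVar L × Fin 3) ℝ))⁻¹ *ᵥ
          frameGrad (L := L) fixFrameStd (ringCoord L ((Fin.cons (glue x.1) x.2.1 : Fin (2 * L - 1 + 1) → GaugeConfig 3 L SU2), x.2.2)))) ∧
      ∑ va, frameD (fixFrameStd va) (c1 va) (ringCoord L ((Fin.cons (glue x.1) x.2.1 : Fin (2 * L - 1 + 1) → GaugeConfig 3 L SU2), x.2.2)) ≤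
        18 * (L : ℝ) ^ 4 - 3 / 4 ∧
      (∀ va, c1 va (ringCoord L ((Fin.cons (glue x.1) x.2.1 : Fin (2 * L - 1 + 1) → GaugeConfig 3 L SU2), x.2.2)) =
        ((frameHess (L := L) fixFrameStd (ringCoord L ((Fin.cons (glue x.1) x.2.1 : Fin (2 * L - 1 + 1) → GaugeConfig 3 L SU2), x.2.2)) +
          (ε * ((ρ / Real.sqrt 2) ^ 2 / (1032960 * (L : ℝ) ^ 8)) / 3) • (1 : Matrix (FixVar L × Fin 3) (FixVar L × Fin 3) ℝ))⁻¹ *ᵥ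
          frameGrad (L := L) fixFrameStd (ringCoord L ((Fin.cons (glue x.1) x.2.1 : Fin (2 * L - 1 + 1) → GaugeConfig 3 L SU2), x.2.2))) va) ∧
      (∀ k : Fin 3, ∑ va, ((frameHess (L := L) fixFrameStd (ringCoord L ((Fin.cons (glue x.1) x.2.1 : Fin (2 * L - 1 + 1) → GaugeConfig 3 L SU2), x.2.2)) +
          (ε * ((ρ / Real.sqrt 2) ^ 2 / (1032960 * (L : ℝ) ^ 8)) / 3) • (1 : Matrix (FixVar L × Fin 3) (FixVar L × Fin 3) ℝ))⁻¹ *ᵥ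
          frameGrad (L := L) fixFrameStd (ringCoord L ((Fin.cons (glue x.1) x.2.1 : Fin (2 * L - 1 + 1) → GaugeConfig 3 L SU2), x.2.2))) va *
          frameD (fixFrameStd va) (linkMass k) (ringCoord L ((Fin.cons (glue x.1) x.2.1 : Fin (2 * L - 1 + 1) → GaugeConfig 3 L SU2), x.2.2)) ≤
        (Real.sqrt ((Fintype.card (FixVar L × Fin 3) : ℝ) * (2 * (C₂ * (L : ℝ) ^ 4)) /
          ((ε * ((ρ / Real.sqrt 2) ^ 2 / (1032960 * (L : ℝ) ^ 8)) / 3) / 2) ^ 2) * Real.sqrt (4 * (Fintype.card (FixVar L × Fin 3) : ℝ))) *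
        Real.sqrt t₀) ∧
      ∑ va, ((frameHess (L := L) fixFrameStd (ringCoord L ((Fin.cons (glue x.1) x.2.1 : Fin (2 * L - 1 + 1) → GaugeConfig 3 L SU2), x.2.2)) +
          (ε * ((ρ / Real.sqrt 2) ^ 2 / (1032960 * (L : ℝ) ^ 8)) / 3) • (1 : Matrix (FixVar L × Fin 3) (FixVar L × Fin 3) ℝ))⁻¹ *ᵥ
          frameGrad (L := L) fixFrameStd (ringCoord L ((Fin.cons (glue x.1) x.2.1 : Fin (2 * L - 1 + 1) → GaugeConfig 3 L SU2), x.2.2))) va *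
          frameD (fixFrameStd va) seamMass (ringCoord L ((Fin.cons (glue x.1) x.2.1 : Fin (2 * L - 1 + 1) → GaugeConfig 3 L SU2), x.2.2)) ≤
        (Real.sqrt ((Fintype.card (FixVar L × Fin 3) : ℝ) * (2 * (C₂ * (L : ℝ) ^ 4)) /
          ((ε * ((ρ / Real.sqrt 2) ^ 2 / (1032960 * (L : ℝ) ^ 8)) / 3) / 2) ^ 2) * Real.sqrt (4 * (Fintype.card (FixVar L × Fin 3) : ℝ))) *
        Real.sqrt t₀ := by
    intro x hm hF
    obtain ⟨h1, h2, h3, h4, h5, h6, h7⟩ :=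
      generic_collar_package (L := L) hρ0 hρ1 hK₃0 hε0 hε1 hK3 hC₂0 hC₂ ht₀G hδ' hδ x hm hF
    have h4' : ∑ va, frameD (fixFrameStd va) (c1 va) (ringCoord L ((Fin.cons (glue x.1) x.2.1 : Fin (2 * L - 1 + 1) → GaugeConfig 3 L SU2), x.2.2)) ≤
        (Fintype.card (FixVar L × Fin 3) : ℝ) - 4 + 1 / 4 := h4
    rw [hcard] at h4'
    exact ⟨h1, h2, h3, by linarith only [h4'], h5, h6, h7⟩
  have hCen : ∀ x : (OffIdx L → SU2) × ((Fin (2 * L - 1) → GaugeConfig 3 L SU2) × (Site 3 L → SU2)),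
      (∀ k : Fin 3, linkMass k (ringCoord L ((Fin.cons (glue x.1) x.2.1 : Fin (2 * L - 1 + 1) → GaugeConfig 3 L SU2), x.2.2)) ≤ ρ ^ 2) →
      seamMass (ringCoord L ((Fin.cons (glue x.1) x.2.1 : Fin (2 * L - 1 + 1) → GaugeConfig 3 L SU2), x.2.2)) ≤ ρ ^ 2 →
      ringDeficit L (fun _ => false) ((Fin.cons (glue x.1) x.2.1 : Fin (2 * L - 1 + 1) → GaugeConfig 3 L SU2), x.2.2) ≤ t₀ →
      2 * (1 - ε) * ringDeficit L (fun _ => false) ((Fin.cons (glue x.1) x.2.1 : Fin (2 * L - 1 + 1) → GaugeConfig 3 L SU2), x.2.2) ≤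
          ∑ va, C va (ringCoord L ((Fin.cons (glue x.1) x.2.1 : Fin (2 * L - 1 + 1) → GaugeConfig 3 L SU2), x.2.2)) *
            frameGrad (L := L) fixFrameStd (ringCoord L ((Fin.cons (glue x.1) x.2.1 : Fin (2 * L - 1 + 1) → GaugeConfig 3 L SU2), x.2.2)) va ∧
      0 ≤ ∑ va, C va (ringCoord L ((Fin.cons (glue x.1) x.2.1 : Fin (2 * L - 1 + 1) → GaugeConfig 3 L SU2), x.2.2)) *
            frameGrad (L := L) fixFrameStd (ringCoord L ((Fin.cons (glue x.1) x.2.1 : Fin (2 * L - 1 + 1) → GaugeConfig 3 L SU2), x.2.2)) va ∧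
      ∑ va, frameD (fixFrameStd va) (C va) (ringCoord L ((Fin.cons (glue x.1) x.2.1 : Fin (2 * L - 1 + 1) → GaugeConfig 3 L SU2), x.2.2)) ≤
          18 * (L : ℝ) ^ 4 - 1 / 2 ∧
      (∀ k : Fin 3, -(N * Real.sqrt t₀) ≤
          ∑ va, C va (ringCoord L ((Fin.cons (glue x.1) x.2.1 : Fin (2 * L - 1 + 1) → GaugeConfig 3 L SU2), x.2.2)) *
            frameD (fixFrameStd va) (linkMass k) (ringCoord L ((Fin.cons (glue x.1) x.2.1 : Fin (2 * L - 1 + 1) → GaugeConfig 3 L SU2), x.2.2))) ∧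
      -(N * Real.sqrt t₀) ≤
          ∑ va, C va (ringCoord L ((Fin.cons (glue x.1) x.2.1 : Fin (2 * L - 1 + 1) → GaugeConfig 3 L SU2), x.2.2)) *
            frameD (fixFrameStd va) seamMass (ringCoord L ((Fin.cons (glue x.1) x.2.1 : Fin (2 * L - 1 + 1) → GaugeConfig 3 L SU2), x.2.2)) := by
    intro x hk hs' hF
    exact central_window_package (L := L) ht₀C hN0 hεCε hε1 hP x hk hs' hF
  have hbridgeG : ∀ {M : (Fin (2 * L - 1 + 1) → Edge 3 L → Matrix (Fin 2) (Fin 2) ℂ) × (Site 3 L → Matrix (Fin 2) (Fin 2) ℂ)},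
      regCutoff ρ M ≠ 0 → (∃ k : Fin 3, ρ ^ 2 / 2 ≤ linkMass k M) ∨ ρ ^ 2 / 2 ≤ seamMass M := fun h => mass_of_regCutoff_ne_zero hρ0 h
  have hbridgeC : ∀ {M : (Fin (2 * L - 1 + 1) → Edge 3 L → Matrix (Fin 2) (Fin 2) ℂ) × (Site 3 L → Matrix (Fin 2) (Fin 2) ℂ)},
      regCutoff ρ M ≠ 1 → (∀ k : Fin 3, linkMass k M ≤ ρ ^ 2) ∧ seamMass M ≤ ρ ^ 2 := fun h => mass_of_regCutoff_ne_one hρ0 h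
  /- ### the seven clauses -/
  have hB34 : (3 : ℝ) / 4 ≤ 18 * (L : ℝ) ^ 4 := by linarith only [hL4]
  refine ⟨cf, ε, hcfs, hε0.le, hε4, hεL, fun x => ?_, fun x hFx => ?_, fun x => ?_⟩
  · /- (pos) -/
    have hF0 : 0 ≤ ringDeficit L (fun _ => false) ((Fin.cons (glue x.1) x.2.1 : Fin (2 * L - 1 + 1) → GaugeConfig 3 L SU2), x.2.2) :=
      ringDeficit_nonneg _ _
    have e : ∑ va, cf va (ringCoord L ((Fin.cons (glue x.1) x.2.1 : Fin (2 * L - 1 + 1) → GaugeConfig 3 L SU2), x.2.2)) *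
        frameGrad (L := L) fixFrameStd (ringCoord L ((Fin.cons (glue x.1) x.2.1 : Fin (2 * L - 1 + 1) → GaugeConfig 3 L SU2), x.2.2)) va =
        deficitStep (ringPoly L (ringCoord L ((Fin.cons (glue x.1) x.2.1 : Fin (2 * L - 1 + 1) → GaugeConfig 3 L SU2), x.2.2)) / t₀) *
          (regCutoff ρ (ringCoord L ((Fin.cons (glue x.1) x.2.1 : Fin (2 * L - 1 + 1) → GaugeConfig 3 L SU2), x.2.2)) *
            (θf (ringCoord L ((Fin.cons (glue x.1) x.2.1 : Fin (2 * L - 1 + 1) → GaugeConfig 3 L SU2), x.2.2)) *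
              (frameGrad (L := L) fixFrameStd (ringCoord L ((Fin.cons (glue x.1) x.2.1 : Fin (2 * L - 1 + 1) → GaugeConfig 3 L SU2), x.2.2)) ⬝ᵥ
                ((frameHess (L := L) fixFrameStd (ringCoord L ((Fin.cons (glue x.1) x.2.1 : Fin (2 * L - 1 + 1) → GaugeConfig 3 L SU2), x.2.2)) +
                  (ε * ((ρ / Real.sqrt 2) ^ 2 / (1032960 * (L : ℝ) ^ 8)) / 3) • (1 : Matrix (FixVar L × Fin 3) (FixVar L × Fin 3) ℝ))⁻¹ *ᵥ
                  frameGrad (L := L) fixFrameStd (ringCoord L ((Fin.cons (glue x.1) x.2.1 : Fin (2 * L - 1 + 1) → GaugeConfig 3 L SU2), x.2.2))))) +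
          (1 - regCutoff ρ (ringCoord L ((Fin.cons (glue x.1) x.2.1 : Fin (2 * L - 1 + 1) → GaugeConfig 3 L SU2), x.2.2))) *
            ∑ va, C va (ringCoord L ((Fin.cons (glue x.1) x.2.1 : Fin (2 * L - 1 + 1) → GaugeConfig 3 L SU2), x.2.2)) *
              frameGrad (L := L) fixFrameStd (ringCoord L ((Fin.cons (glue x.1) x.2.1 : Fin (2 * L - 1 + 1) → GaugeConfig 3 L SU2), x.2.2)) va) := by
      simp only [hcfdef, hc1def]
      rw [sum_patch_mul, sum_two_mul_resolventCoeff_mul_frameGrad]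
    rw [e]
    refine pos_budget (deficitStep_nonneg _) (regCutoff_nonneg _ _) (regCutoff_le_one _ _) (fun hψ hχ => ?_) (fun hψ hχ => ?_)
    · have hF := (ringPoly_lt_of_deficitLevel_ne_zero ht₀0 hψ).le
      rw [← ringDeficit_eq_ringPoly] at hF
      obtain ⟨hθ1, hnn, -, -, -, -, -⟩ := hG x (hbridgeG hχ) hF
      exact ⟨hθ1, hnn⟩
    · have hF := (ringPoly_lt_of_deficitLevel_ne_zero ht₀0 hψ).le
      rw [← ringDeficit_eq_ringPoly] at hF
      obtain ⟨hk, hs'⟩ := hbridgeC hχ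
      exact (hCen x hk hs' hF).2.1
  · /- (drive) -/
    rw [hwin] at hFx
    have hF0 : 0 ≤ ringDeficit L (fun _ => false) ((Fin.cons (glue x.1) x.2.1 : Fin (2 * L - 1 + 1) → GaugeConfig 3 L SU2), x.2.2) :=
      ringDeficit_nonneg _ _
    have hF : ringDeficit L (fun _ => false) ((Fin.cons (glue x.1) x.2.1 : Fin (2 * L - 1 + 1) → GaugeConfig 3 L SU2), x.2.2) ≤ t₀ := by
      linarith only [hFx, ht₀0]
    have hF2 : ringPoly L (ringCoord L ((Fin.cons (glue x.1) x.2.1 : Fin (2 * L - 1 + 1) → GaugeConfig 3 L SU2), x.2.2)) ≤ t₀ / 2 := by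
      rw [← ringDeficit_eq_ringPoly]; exact hFx.le
    have e : ∑ va, cf va (ringCoord L ((Fin.cons (glue x.1) x.2.1 : Fin (2 * L - 1 + 1) → GaugeConfig 3 L SU2), x.2.2)) *
        frameGrad (L := L) fixFrameStd (ringCoord L ((Fin.cons (glue x.1) x.2.1 : Fin (2 * L - 1 + 1) → GaugeConfig 3 L SU2), x.2.2)) va =
        deficitStep (ringPoly L (ringCoord L ((Fin.cons (glue x.1) x.2.1 : Fin (2 * L - 1 + 1) → GaugeConfig 3 L SU2), x.2.2)) / t₀) *
          (regCutoff ρ (ringCoord L ((Fin.cons (glue x.1) x.2.1 : Fin (2 * L - 1 + 1) → GaugeConfig 3 L SU2), x.2.2)) *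
            (θf (ringCoord L ((Fin.cons (glue x.1) x.2.1 : Fin (2 * L - 1 + 1) → GaugeConfig 3 L SU2), x.2.2)) *
              (frameGrad (L := L) fixFrameStd (ringCoord L ((Fin.cons (glue x.1) x.2.1 : Fin (2 * L - 1 + 1) → GaugeConfig 3 L SU2), x.2.2)) ⬝ᵥ
                ((frameHess (L := L) fixFrameStd (ringCoord L ((Fin.cons (glue x.1) x.2.1 : Fin (2 * L - 1 + 1) → GaugeConfig 3 L SU2), x.2.2)) +
                  (ε * ((ρ / Real.sqrt 2) ^ 2 / (1032960 * (L : ℝ) ^ 8)) / 3) • (1 : Matrix (FixVar L × Fin 3) (FixVar L × Fin 3) ℝ))⁻¹ *ᵥ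
                  frameGrad (L := L) fixFrameStd (ringCoord L ((Fin.cons (glue x.1) x.2.1 : Fin (2 * L - 1 + 1) → GaugeConfig 3 L SU2), x.2.2))))) +
          (1 - regCutoff ρ (ringCoord L ((Fin.cons (glue x.1) x.2.1 : Fin (2 * L - 1 + 1) → GaugeConfig 3 L SU2), x.2.2))) *
            ∑ va, C va (ringCoord L ((Fin.cons (glue x.1) x.2.1 : Fin (2 * L - 1 + 1) → GaugeConfig 3 L SU2), x.2.2)) *
              frameGrad (L := L) fixFrameStd (ringCoord L ((Fin.cons (glue x.1) x.2.1 : Fin (2 * L - 1 + 1) → GaugeConfig 3 L SU2), x.2.2)) va) := by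
      simp only [hcfdef, hc1def]
      rw [sum_patch_mul, sum_two_mul_resolventCoeff_mul_frameGrad]
    rw [e, deficitLevel_eq_one ht₀0 hF2, one_mul]
    refine drive_budget (εC := ε) (regCutoff_nonneg _ _) (regCutoff_le_one _ _) hF0 le_rfl (fun hχ => ?_) (fun hχ => ?_)
    · obtain ⟨hθ1, -, hdr, -, -, -, -⟩ := hG x (hbridgeG hχ) hF
      exact ⟨hθ1, by linarith only [hdr]⟩
    · obtain ⟨hk, hs'⟩ := hbridgeC hχ
      exact (hCen x hk hs' hF).1
  · /- (div) -/
    have hF0 : 0 ≤ ringDeficit L (fun _ => false) ((Fin.cons (glue x.1) x.2.1 : Fin (2 * L - 1 + 1) → GaugeConfig 3 L SU2), x.2.2) :=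
      ringDeficit_nonneg _ _
    have e0 : ∑ va, frameD (fixFrameStd va) (cf va) (ringCoord L ((Fin.cons (glue x.1) x.2.1 : Fin (2 * L - 1 + 1) → GaugeConfig 3 L SU2), x.2.2)) =
        ∑ va, frameD (fixFrameStd va) (fun M' => deficitStep (ringPoly L M' / t₀) * (regCutoff ρ M' * c1 va M' + (1 - regCutoff ρ M') * C va M'))
          (ringCoord L ((Fin.cons (glue x.1) x.2.1 : Fin (2 * L - 1 + 1) → GaugeConfig 3 L SU2), x.2.2)) := by
      simp only [hcfdef]
    rw [e0, sum_frameD_patch fixFrameStd (contDiff_regCutoff ρ) hc1s hCs t₀]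
    -- the drive inside the `ψ′`-term
    have e1 : ∑ j, frameGrad (L := L) fixFrameStd (ringCoord L ((Fin.cons (glue x.1) x.2.1 : Fin (2 * L - 1 + 1) → GaugeConfig 3 L SU2), x.2.2)) j *
        (regCutoff ρ (ringCoord L ((Fin.cons (glue x.1) x.2.1 : Fin (2 * L - 1 + 1) → GaugeConfig 3 L SU2), x.2.2)) *
          c1 j (ringCoord L ((Fin.cons (glue x.1) x.2.1 : Fin (2 * L - 1 + 1) → GaugeConfig 3 L SU2), x.2.2)) +
         (1 - regCutoff ρ (ringCoord L ((Fin.cons (glue x.1) x.2.1 : Fin (2 * L - 1 + 1) → GaugeConfig 3 L SU2), x.2.2))) *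
          C j (ringCoord L ((Fin.cons (glue x.1) x.2.1 : Fin (2 * L - 1 + 1) → GaugeConfig 3 L SU2), x.2.2))) =
        regCutoff ρ (ringCoord L ((Fin.cons (glue x.1) x.2.1 : Fin (2 * L - 1 + 1) → GaugeConfig 3 L SU2), x.2.2)) *
          (θf (ringCoord L ((Fin.cons (glue x.1) x.2.1 : Fin (2 * L - 1 + 1) → GaugeConfig 3 L SU2), x.2.2)) *
            (frameGrad (L := L) fixFrameStd (ringCoord L ((Fin.cons (glue x.1) x.2.1 : Fin (2 * L - 1 + 1) → GaugeConfig 3 L SU2), x.2.2)) ⬝ᵥ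
              ((frameHess (L := L) fixFrameStd (ringCoord L ((Fin.cons (glue x.1) x.2.1 : Fin (2 * L - 1 + 1) → GaugeConfig 3 L SU2), x.2.2)) +
                (ε * ((ρ / Real.sqrt 2) ^ 2 / (1032960 * (L : ℝ) ^ 8)) / 3) • (1 : Matrix (FixVar L × Fin 3) (FixVar L × Fin 3) ℝ))⁻¹ *ᵥ
                frameGrad (L := L) fixFrameStd (ringCoord L ((Fin.cons (glue x.1) x.2.1 : Fin (2 * L - 1 + 1) → GaugeConfig 3 L SU2), x.2.2))))) +
        (1 - regCutoff ρ (ringCoord L ((Fin.cons (glue x.1) x.2.1 : Fin (2 * L - 1 + 1) → GaugeConfig 3 L SU2), x.2.2))) *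
          ∑ j, C j (ringCoord L ((Fin.cons (glue x.1) x.2.1 : Fin (2 * L - 1 + 1) → GaugeConfig 3 L SU2), x.2.2)) *
            frameGrad (L := L) fixFrameStd (ringCoord L ((Fin.cons (glue x.1) x.2.1 : Fin (2 * L - 1 + 1) → GaugeConfig 3 L SU2), x.2.2)) j := by
      rw [← sum_two_mul_resolventCoeff_mul_frameGrad]
      simp only [hc1def, Finset.mul_sum, ← Finset.sum_add_distrib]
      exact Finset.sum_congr rfl fun j _ => by ring
    rw [e1]
    have hb := div_budget (B := 18 * (L : ℝ) ^ 4)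
      (ψv := deficitStep (ringPoly L (ringCoord L ((Fin.cons (glue x.1) x.2.1 : Fin (2 * L - 1 + 1) → GaugeConfig 3 L SU2), x.2.2)) / t₀))
      (χv := regCutoff ρ (ringCoord L ((Fin.cons (glue x.1) x.2.1 : Fin (2 * L - 1 + 1) → GaugeConfig 3 L SU2), x.2.2)))
      (dψ := deriv deficitStep (ringPoly L (ringCoord L ((Fin.cons (glue x.1) x.2.1 : Fin (2 * L - 1 + 1) → GaugeConfig 3 L SU2), x.2.2)) / t₀))
      (t₀ := t₀)
      (D₁ := ∑ j, frameD (fixFrameStd j) (c1 j) (ringCoord L ((Fin.cons (glue x.1) x.2.1 : Fin (2 * L - 1 + 1) → GaugeConfig 3 L SU2), x.2.2)))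
      (D₂ := ∑ j, frameD (fixFrameStd j) (C j) (ringCoord L ((Fin.cons (glue x.1) x.2.1 : Fin (2 * L - 1 + 1) → GaugeConfig 3 L SU2), x.2.2)))
      (X := ∑ j, frameD (fixFrameStd j) (regCutoff ρ) (ringCoord L ((Fin.cons (glue x.1) x.2.1 : Fin (2 * L - 1 + 1) → GaugeConfig 3 L SU2), x.2.2)) *
        (c1 j (ringCoord L ((Fin.cons (glue x.1) x.2.1 : Fin (2 * L - 1 + 1) → GaugeConfig 3 L SU2), x.2.2)) -
          C j (ringCoord L ((Fin.cons (glue x.1) x.2.1 : Fin (2 * L - 1 + 1) → GaugeConfig 3 L SU2), x.2.2))))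
      (θv := θf (ringCoord L ((Fin.cons (glue x.1) x.2.1 : Fin (2 * L - 1 + 1) → GaugeConfig 3 L SU2), x.2.2)))
      (d₁ := frameGrad (L := L) fixFrameStd (ringCoord L ((Fin.cons (glue x.1) x.2.1 : Fin (2 * L - 1 + 1) → GaugeConfig 3 L SU2), x.2.2)) ⬝ᵥ
              ((frameHess (L := L) fixFrameStd (ringCoord L ((Fin.cons (glue x.1) x.2.1 : Fin (2 * L - 1 + 1) → GaugeConfig 3 L SU2), x.2.2)) +
                (ε * ((ρ / Real.sqrt 2) ^ 2 / (1032960 * (L : ℝ) ^ 8)) / 3) • (1 : Matrix (FixVar L × Fin 3) (FixVar L × Fin 3) ℝ))⁻¹ *ᵥ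
                frameGrad (L := L) fixFrameStd (ringCoord L ((Fin.cons (glue x.1) x.2.1 : Fin (2 * L - 1 + 1) → GaugeConfig 3 L SU2), x.2.2))))
      (d₂ := ∑ j, C j (ringCoord L ((Fin.cons (glue x.1) x.2.1 : Fin (2 * L - 1 + 1) → GaugeConfig 3 L SU2), x.2.2)) *
            frameGrad (L := L) fixFrameStd (ringCoord L ((Fin.cons (glue x.1) x.2.1 : Fin (2 * L - 1 + 1) → GaugeConfig 3 L SU2), x.2.2)) j)
      (deficitStep_nonneg _) (deficitStep_le_one _) (regCutoff_nonneg ρ _) (regCutoff_le_one ρ _) (deriv_deficitStep_nonpos _) ht₀0 hB34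
      (fun hψ hχ => ?_) (fun hψ hχ => ?_) (fun hψ => ?_) (fun hdψ hχ => ?_) (fun hdψ hχ => ?_)
    · linarith only [hb]
    · -- `div c¹ ≤ 18L⁴ − 3/4` on the generic window
      have hF := (ringPoly_lt_of_deficitLevel_ne_zero ht₀0 hψ).le
      rw [← ringDeficit_eq_ringPoly] at hF
      exact (hG x (hbridgeG hχ) hF).2.2.2.1
    · -- `div C ≤ 18L⁴ − 1/2` on the central window
      have hF := (ringPoly_lt_of_deficitLevel_ne_zero ht₀0 hψ).le
      rw [← ringDeficit_eq_ringPoly] at hF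
      obtain ⟨hk, hs'⟩ := hbridgeC hχ
      exact (hCen x hk hs' hF).2.2.1
    · -- the SIGNED CROSS TERM
      have hF := (ringPoly_lt_of_deficitLevel_ne_zero ht₀0 hψ).le
      rw [← ringDeficit_eq_ringPoly] at hF
      by_cases hcore : (∀ k : Fin 3, linkMass k (ringCoord L ((Fin.cons (glue x.1) x.2.1 : Fin (2 * L - 1 + 1) → GaugeConfig 3 L SU2), x.2.2)) < ρ ^ 2 / 2) ∧
          seamMass (ringCoord L ((Fin.cons (glue x.1) x.2.1 : Fin (2 * L - 1 + 1) → GaugeConfig 3 L SU2), x.2.2)) < ρ ^ 2 / 2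
      · simp only [frameD_regCutoff_eq_zero_of_core hρ0 hcore.1 hcore.2, zero_mul, Finset.sum_const_zero]
        norm_num
      by_cases hregl : (∃ k : Fin 3, ρ ^ 2 < linkMass k (ringCoord L ((Fin.cons (glue x.1) x.2.1 : Fin (2 * L - 1 + 1) → GaugeConfig 3 L SU2), x.2.2))) ∨
          ρ ^ 2 < seamMass (ringCoord L ((Fin.cons (glue x.1) x.2.1 : Fin (2 * L - 1 + 1) → GaugeConfig 3 L SU2), x.2.2))
      · simp only [frameD_regCutoff_eq_zero_of_regular hρ0 hregl, zero_mul, Finset.sum_const_zero]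
        norm_num
      -- the collar: both packages hold
      obtain ⟨hmassG, hmassC⟩ := collar_masses hcore hregl
      obtain ⟨-, -, -, -, hc1v, hmk, hms⟩ := hG x hmassG hF
      obtain ⟨-, -, -, hCk, hCs'⟩ := hCen x hmassC.1 hmassC.2 hF
      simp only [hc1v]
      refine (regCutoff_cross_le fixFrameStd hDψ hρ0 _ _
        (fun j => C j (ringCoord L ((Fin.cons (glue x.1) x.2.1 : Fin (2 * L - 1 + 1) → GaugeConfig 3 L SU2), x.2.2)))
        (mul_nonneg hAG0 (Real.sqrt_nonneg _)) (mul_nonneg hN0 (Real.sqrt_nonneg _)) hmk hms hCk hCs').trans ?_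
      have e3 : 4 * (Dψ / ρ ^ 2) * ((Real.sqrt ((Fintype.card (FixVar L × Fin 3) : ℝ) * (2 * (C₂ * (L : ℝ) ^ 4)) /
          ((ε * ((ρ / Real.sqrt 2) ^ 2 / (1032960 * (L : ℝ) ^ 8)) / 3) / 2) ^ 2) * Real.sqrt (4 * (Fintype.card (FixVar L × Fin 3) : ℝ))) *
        Real.sqrt t₀ + N * Real.sqrt t₀) = 4 * (Dψ / ρ ^ 2) * ((Real.sqrt ((Fintype.card (FixVar L × Fin 3) : ℝ) * (2 * (C₂ * (L : ℝ) ^ 4)) /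
          ((ε * ((ρ / Real.sqrt 2) ^ 2 / (1032960 * (L : ℝ) ^ 8)) / 3) / 2) ^ 2) * Real.sqrt (4 * (Fintype.card (FixVar L × Fin 3) : ℝ))) + N) * Real.sqrt t₀ := by ring
      rw [e3]
      exact hcross
    · have hF := ringPoly_le_of_deriv_deficitLevel_ne_zero ht₀0 hdψ
      rw [← ringDeficit_eq_ringPoly] at hF
      obtain ⟨hθ1, hnn, -, -, -, -, -⟩ := hG x (hbridgeG hχ) hF
      exact ⟨hθ1, hnn⟩
    · have hF := ringPoly_le_of_deriv_deficitLevel_ne_zero ht₀0 hdψ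
      rw [← ringDeficit_eq_ringPoly] at hF
      obtain ⟨hk, hs'⟩ := hbridgeC hχ
      exact (hCen x hk hs' hF).2.1

end Summit.QuantumFields.YangMills.Theorems.VirialFluxGap.FrameHessian

end
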